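/-
Copyright: the b2b-balaban T⁴-continuum CRUX team, row NE7b OWNER lineage `t4-ne7b-p1` (gen 144). Project licence.
-/
import Mathlib.MeasureTheory.Integral.Bochner.Basic

/-!
# SMALL FINITE-SUM TOOLS FOR THE SLOT LETTERS OF THE ORDER-FIVE ENTRY MAJORANT (the order-5 block of the kernel-letter CLASS MAP; Mathlib
# only).  (610)'s majorant is a sum of 52 non-negative terms, some of them `ite`-supported; the slot files bound its quadruple sums term by
# term with landed lemmas stated for `Σ|T|`.  Tools: a quadruple sum is below the sum of absolute values; `|if P then 0 else B| ≤ B` and the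
# nested variant for `B ≥ 0`; `Σ(f+g) = Σf + Σg` over four indices as a rewrite rule found by unification (so no `simp` traverses the
# written-out majorant); a non-negative constant through a quadruple sum (row NE7b, node U5c; Mathlib only; [folklore])

Cell `pub-balaban`, sub-cell `t4`, spine estimate NE7b (`T4WeightBudget.RelWeightBound`; the cell's OWN estimate — NOT PRINTED in
[Bałaban 1983–89], NOT PROVED).  Crux-route work under `Spine/NE7b/` by the row OWNER (`t4-ne7b-p1` gen 144, file (611)) under FREEZE
(0)'s crux-prover clause; NOTHING of Bałaban's is named as a Lean object, valued or asserted; no `T4Continuum/Support` leaf typed; no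
`def`, no notation; zero `sorry`.  Imports: Mathlib only.

WHAT IS PROVED ([folklore]): `sum4_le_abs`, `abs_ite_le`, `abs_ite_ite_le`, `sum4_add`, `const_mul_sum4_le`; toy.

HONEST (what this is NOT).  Bookkeeping only.  Scalar skeleton ((A3), NC-NE7b-α UNRULED); nothing of Bałaban's asserted.  BY-NAME EFFECT ON
THE WALL: NONE.  NE7b NOT PRINTED ∕ NOT PROVED; spine PROVED 0∕9; rung (B)+1 — the programme's measures remain FINITE-torus statements; NOT the
mass gap, NOT Clay.  HONEST DEPENDENCY: continuum YM on T⁴ ⇐ BetaPertH ∧ nine spine estimates (0∕9 proved); BetaPertH ⇐ (D1) ∧ (D4) ∧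
CAP+tail; G-an2-4 gates asym, D1 and NE2∕3∕4.
-/

set_option autoImplicit false

noncomputable section

namespace Summit.QuantumFields.BalabanUV.T4Continuum.NE7b.SupFifthKernelSlotTools

open Finset
open scoped BigOperators

variable {ι κ : Type} [Fintype ι] [DecidableEq ι] [Fintype κ] [DecidableEq κ]

omit [DecidableEq ι] [Fintype κ] [DecidableEq κ] in
/-- `Σ f ≤ Σ |f|` over four indices. [folklore] -/
theorem sum4_le_abs (f : ι → ι → ι → ι → ℝ) : ∑ y, ∑ z, ∑ t, ∑ s, f y z t s ≤ ∑ y, ∑ z, ∑ t, ∑ s, |f y z t s| :=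
  Finset.sum_le_sum fun _ _ => Finset.sum_le_sum fun _ _ => Finset.sum_le_sum fun _ _ => Finset.sum_le_sum fun _ _ => le_abs_self _

omit [Fintype ι] [DecidableEq ι] [Fintype κ] [DecidableEq κ] in
/-- `|if P then 0 else B| ≤ B` for `B ≥ 0`. [folklore] -/
theorem abs_ite_le {P : Prop} [Decidable P] {B : ℝ} (hB : 0 ≤ B) : |(if P then (0:ℝ) else B)| ≤ B := by
  split_ifs
  · rw [abs_zero]; exact hB
  · rw [abs_of_nonneg hB]

omit [Fintype ι] [DecidableEq ι] [Fintype κ] [DecidableEq κ] in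
/-- `|if P then 0 else if Q then 0 else B| ≤ B` for `B ≥ 0`. [folklore] -/
theorem abs_ite_ite_le {P Q : Prop} [Decidable P] [Decidable Q] {B : ℝ} (hB : 0 ≤ B) :
    |(if P then (0:ℝ) else if Q then (0:ℝ) else B)| ≤ B := by
  split_ifs
  · rw [abs_zero]; exact hB
  · rw [abs_zero]; exact hB
  · rw [abs_of_nonneg hB]

omit [DecidableEq ι] [Fintype κ] [DecidableEq κ] in
/-- `Σ(f + g) = Σf + Σg` over four indices, as a rewrite rule found by unification (no `simp` traversal of the majorant). [folklore] -/
theorem sum4_add (f g : ι → ι → ι → ι → ℝ) :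
    ∑ y, ∑ z, ∑ t, ∑ s, (f y z t s + g y z t s) = (∑ y, ∑ z, ∑ t, ∑ s, f y z t s) + ∑ y, ∑ z, ∑ t, ∑ s, g y z t s := by
  simp only [Finset.sum_add_distrib]

omit [DecidableEq ι] [Fintype κ] [DecidableEq κ] in
/-- A non-negative constant through a quadruple sum. [folklore] -/
theorem const_mul_sum4_le {f : ι → ι → ι → ι → ℝ} {C B : ℝ} (hC : 0 ≤ C) (h : ∑ y, ∑ z, ∑ t, ∑ s, f y z t s ≤ B) :
    ∑ y, ∑ z, ∑ t, ∑ s, C * f y z t s ≤ C * B := by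
  simp_rw [← Finset.mul_sum]
  exact mul_le_mul_of_nonneg_left h hC

/-- Toy: `|if P then 0 else 3| ≤ 3`. -/
example (P : Prop) [Decidable P] : |(if P then (0:ℝ) else 3)| ≤ 3 := abs_ite_le (by norm_num)

end Summit.QuantumFields.BalabanUV.T4Continuum.NE7b.SupFifthKernelSlotTools

end
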